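import Literature.NumberTheory.Automorphic.OrbitalMeasureAtPointConj
import Literature.NumberTheory.Rogawski1990.AdelicStableOrbitalEulerDischargeG2Semisimple
import Literature.NumberTheory.Rogawski1990.MatchingAdeleGKConjSemisimple
import Literature.NumberTheory.Rogawski1990.LocalTransferTransportAtPoint
import HarnessLib

/-!
# The normalisation binders `hnorm` ∕ `hnorm′` ∕ `hnormγ` of the singular O7 heads are THEOREMS of the pin «`∃ S₀, IsNormalisedOff` at the RATIONAL class»:
# `IsNormalisedOff` at every matching adèle over a SEMISIMPLE `γ₀`, admissibility only
(Rogawski, *Automorphic Representations of Unitary Groups in Three Variables* (1990), §3.3 p. 21, §4.3 p. 44, §14.2 p. 232; Kottwitz,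
*Stable trace formula: elliptic singular terms* (1986), Prop. 7.1, §7.3)

Topic `NumberTheory/Rogawski1990`; namespace `Literature.NumberTheory.Rogawski1990`.  THEOREMS ONLY: no definition, no named fact, no instance, no notation,
no `sorry`.  Cell `pub/hodgecm-mathlib`, ENGINE T1 (crux H413 = `stmt-HodgeConjecture-24833`), row O7 «singular semisimple classes», SPEC-O7 (ix-s) v1.1 +
erratum (E1): at singular ∕ central classes the local orbital measure families are pinned ADMISSIBLE (class-locally) and NORMALISED OFF A FINITE SET AT THE
RATIONAL CLASSES — no `IsCanonical`.  The singular heads ★ `MatchingAdeleG.exists_forall_isEulerOnClasses_ofLocalAdelic_of_mul_sub_eq_zero`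
(`AdelicStableOrbitalEulerAtSingularClasses`), ★ K6-ζ `MatchingAdeleG₂.exists_isEulerOnClasses_ofLocalAdelic_of_mul_sub_eq_zero` (ζ1′), ★ ζ1″, and their
consumers (SA-st), (D1-s) carry, per side, the binders `hnormγ : ∃ S₀, IsNormalisedOff … mq (toAdelic γ) S₀` (a rational point) AND
`hnorm : ∀ p : MatchingAdeleG(₂) …, ∃ S₀, IsNormalisedOff … mq p.adele S₀` (every matching adèle — NOT a rational point).  Here `hnorm` becomes a theorem of
`hnormγ` + the class-local admissibility binder `hadm` already carried, and — for the kit's transported family `mq v := (ψ_v)_* mG v` — `hnormγ` AND `hnorm`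
become theorems of the pin at the base class `γ₀ ∈ U(H)(L⁺)` of the INNER form.  Mechanism: a matching adèle's `v`-component is `K_v`-conjugate to the base
point for almost all `v` at a semisimple class (★ K6-α: `MatchingAdeleG₂.eventuallyKConj_rel_of_isSemisimpleElt`, `MatchingAdeleG.eventuallyKConj_of_isSemisimpleElt`,
`eventually_forall_integralConj_cmDatum_of_isSemisimpleElt` — [Kottwitz1986, Prop. 7.1] in `K_v`-form), and the `π(K_v)`-mass of an INVARIANT class measure read
at a point is insensitive to `K_v`-conjugation of the point (★ `OrbitalMeasureFamily.atPoint_conj_apply_image_mk_of_mem`, ★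
`UnitaryGroup.exists_isNormalisedOff_of_eventually_exists_mem_conj`).

* §1 (`U(H₂)` over `γ₀ ∈ U(H₁)(L⁺)`, ★ `MatchingAdeleG₂`) **`MatchingAdeleG₂.forall_exists_isNormalisedOff_of_isSemisimpleElt`** (`hH₂ hdet hγ hss₀ mq hadm hnormγ`),
  `…_of_mul_sub_eq_zero` (`(γ₀ − a)(γ₀ − b) = 0`, `a ≠ b` — the binders of ★ ζ1′ VERBATIM), `…_of_eq_smul_one` (central `γ₀ = ζ • 1`).
* §2 (`U(Φ₃)` over `γ₀ ∈ U(H)(L⁺)`, ★ `MatchingAdeleG`, ABSTRACT `mq`) **`MatchingAdeleG.forall_exists_isNormalisedOff_of_isSemisimpleElt`** (`hγ hss₀ mq hadm hnormγ`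
  — the binders of ★ `AdelicStableOrbitalEulerAtSingularClasses` VERBATIM), `…_of_mul_sub_eq_zero`, `…_of_eq_smul_one`.
* §3 (the kit's dress `mq v := (mG v).transport (ψ v) …`, ★ `OrbitalMeasureFamilyTransport` §3 letters `ψ hcorr' S₀ hψK`; hypotheses ONLY on the inner form:
  `mG v` class-locally admissible at the classes stably conjugate to `(γ₀)_v`, and THE PIN `∃ S₁, IsNormalisedOff L 3 H mG (toAdelic γ₀) S₁`)
  **`exists_isNormalisedOff_transport_of_forall_corresponds`** — `∃ S, IsNormalisedOff L 3 Φ₃ mq x S` at EVERY adelic `x ∈ U(Φ₃)(𝐀)` corresponding to `γ₀`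
  place by place; hence **`exists_isNormalisedOff_transport_toAdelic_of_isSemisimpleElt`** (`hnormγ` for `mq`, at the rational correspondent `γ`) and
  **`forall_exists_isNormalisedOff_transport_matchingAdeleG_of_isSemisimpleElt`** (`hnorm` for `mq`) — the singular twins of ★
  `UnitaryGroup.exists_isNormalisedOff_transport_toAdelic` ∕ `….forall_exists_isNormalisedOff_transport_matchingAdeleG` with canonicity REPLACED by the pin.
NOT here: the endoscopic side (`IsNormalisedOffPair` at singular `H`-classes is read at rational pairs only by ★ H-c); any change to a ★ head (consumers
substitute these theorems for the binders by name).  HC_CM is proved only modulo the printed citations until rung 0 closes; this file is unconditional.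

## References
* [Rogawski1990] J. D. Rogawski, *Automorphic Representations of Unitary Groups in Three Variables*, Ann. of Math. Stud. 123 (1990), §3.3 p. 21, §4.3 p. 44,
  §14.2 p. 232.
* [Kottwitz1986] R. E. Kottwitz, *Stable trace formula: elliptic singular terms*, Math. Ann. 275 (1986), Prop. 7.1, §7.3.
-/

set_option autoImplicit false

noncomputable section

open NumberField IsDedekindDomain Filter MeasureTheory
open scoped Matrix MatrixGroups

namespace Literature.NumberTheory.Rogawski1990

open Literature.NumberTheory.Automorphic Literature.LinearAlgebra.Matrix Literature.MeasureTheory.Group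
open Literature.AlgebraicGeometry.ShimuraVarieties (unitaryGroup)

/-! ## §1 The side `U(H₂)`: `hnorm` from `hnormγ` at a semisimple base class -/

section G2

variable {L : Type} [Field L] [NumberField L] [IsCMField L] {H₁ H₂ : Matrix (Fin 3) (Fin 3) L}
  {γ₀ : (UnitaryGroup.cmDatum L 3 H₁).Rational} {γ : (UnitaryGroup.cmDatum L 3 H₂).Rational}
  [∀ (v : HeightOneSpectrum (𝓞 ↥(maximalRealSubfield L))) (x : (UnitaryGroup.cmDatum L 3 H₂).Local v),
    MeasurableSpace ((UnitaryGroup.cmDatum L 3 H₂).Local v ⧸ Subgroup.centralizer ({x} : Set ((UnitaryGroup.cmDatum L 3 H₂).Local v)))]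
  [∀ (v : HeightOneSpectrum (𝓞 ↥(maximalRealSubfield L))) (x : (UnitaryGroup.cmDatum L 3 H₂).Local v),
    BorelSpace ((UnitaryGroup.cmDatum L 3 H₂).Local v ⧸ Subgroup.centralizer ({x} : Set ((UnitaryGroup.cmDatum L 3 H₂).Local v)))]

/-- **`hnorm` FROM `hnormγ` ON `U(H₂)`, AT A SEMISIMPLE BASE CLASS.**  `H₂` hermitian with `det H₂ ≠ 0`; `γ₀ ∈ U(H₁)(L⁺)` SEMISIMPLE with a rational correspondent
`γ ∈ U(H₂)(L⁺)`; local class-indexed families `mq v` on `U(H₂)(L⁺_v)`, admissible on the classes corresponding to `(γ₀)_v` (`hadm`, the class-local binder of ★ K6-ζ);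
`mq` normalised off a finite set at `toAdelic γ` (`hnormγ`).  THEN `mq` is normalised off a finite set at EVERY matching adèle `p ∈ U(H₂)(𝐀)` over `γ₀`:
for almost all `v`, `p_v = k γ_v k⁻¹` with `k ∈ U(H₂)(𝒪_v)` (★ K6-α `MatchingAdeleG₂.eventuallyKConj_rel_of_isSemisimpleElt` +
★ `MatchingAdeleG₂.eventually_exists_mem_conj_of_eventuallyKConj`), `mq v ⟦γ_v⟧` is invariant (`hadm` at `⟦γ_v⟧`: `(γ₀)_v ↔ γ_v ∼ out ⟦γ_v⟧`), and the
`π U(H₂)(𝒪_v)`-mass at `k γ_v k⁻¹` is the one at `γ_v` (★ `UnitaryGroup.exists_isNormalisedOff_of_eventually_exists_mem_conj`).  No canonicity.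
[cite: Rogawski1990, §3.3 p. 21; §4.3 p. 44] [cite: Kottwitz1986, Prop. 7.1] -/
theorem MatchingAdeleG₂.forall_exists_isNormalisedOff_of_isSemisimpleElt (hH₂ : (H₂.map (cmConjRingHom L))ᵀ = H₂) (hdet : H₂.det ≠ 0)
    (hγ : Corresponds (cmConjRingHom L) H₁ H₂ γ₀ γ) (hss₀ : IsSemisimpleElt (cmConjRingHom L) H₁ γ₀)
    (mq : ∀ v : HeightOneSpectrum (𝓞 ↥(maximalRealSubfield L)), OrbitalMeasureFamily ((UnitaryGroup.cmDatum L 3 H₂).Local v))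
    (hadm : ∀ v, (mq v).IsAdmissibleOn fun x : (UnitaryGroup.cmDatum L 3 H₂).Local v =>
      Corresponds (UnitaryGroup.conjLocal L (IsCMField.complexConj L) v) ((UnitaryGroup.adelicForm L 3 H₁).map (UnitaryGroup.adeleToLocal L v))
        ((UnitaryGroup.adelicForm L 3 H₂).map (UnitaryGroup.adeleToLocal L v)) ((UnitaryGroup.cmDatum L 3 H₁).toLocal v ((UnitaryGroup.cmDatum L 3 H₁).toAdelic γ₀)) x)
    (hnormγ : ∃ S₀ : Finset (HeightOneSpectrum (𝓞 ↥(maximalRealSubfield L))), UnitaryGroup.IsNormalisedOff L 3 H₂ mq ((UnitaryGroup.cmDatum L 3 H₂).toAdelic γ) S₀) :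
    ∀ p : MatchingAdeleG₂ L H₁ H₂ γ₀, ∃ S₀ : Finset (HeightOneSpectrum (𝓞 ↥(maximalRealSubfield L))), UnitaryGroup.IsNormalisedOff L 3 H₂ mq p.adele S₀ :=
  fun p => UnitaryGroup.exists_isNormalisedOff_of_eventually_exists_mem_conj L 3 H₂ mq hnormγ
    (MatchingAdeleG₂.eventually_exists_mem_conj_of_eventuallyKConj
      (MatchingAdeleG₂.eventuallyKConj_rel_of_isSemisimpleElt hH₂ hdet hγ (hγ.isSemisimpleElt_iff.1 hss₀)) hγ p)
    (Filter.Eventually.of_forall fun v =>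
      (hadm v _ ((corresponds_toLocal_toAdelic hγ v).of_isStablyConj_right (isStablyConj_of_isConj (isConj_out_conjClasses_mk _)))).2.1)

/-- **`hnorm` from `hnormγ` on `U(H₂)` at a SPLIT SEMISIMPLE class `(γ₀ − a)(γ₀ − b) = 0`, `a ≠ b`** (the binders `hH₂ hdet hγ hab hγab mq hadm hnormγ` of ★ K6-ζ (ζ1′)
`MatchingAdeleG₂.exists_isEulerOnClasses_ofLocalAdelic_of_mul_sub_eq_zero` VERBATIM; semisimplicity of `γ₀` by ★ ε1 `isSemisimple_toLin'_of_mul_sub_eq_zero`): every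
singular semisimple or central class of the anisotropic `U(H₁)`. [cite: Rogawski1990, §3.3 p. 21; §4.3 p. 44] [cite: Kottwitz1986, Prop. 7.1] -/
theorem MatchingAdeleG₂.forall_exists_isNormalisedOff_of_mul_sub_eq_zero (hH₂ : (H₂.map (cmConjRingHom L))ᵀ = H₂) (hdet : H₂.det ≠ 0)
    (hγ : Corresponds (cmConjRingHom L) H₁ H₂ γ₀ γ) {a b : L} (hab : a ≠ b)
    (hγab : ((((γ₀ : unitaryGroup (cmConjRingHom L) H₁).val : GL (Fin 3) L).val : Matrix (Fin 3) (Fin 3) L) - a • (1 : Matrix (Fin 3) (Fin 3) L)) *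
      ((((γ₀ : unitaryGroup (cmConjRingHom L) H₁).val : GL (Fin 3) L).val : Matrix (Fin 3) (Fin 3) L) - b • (1 : Matrix (Fin 3) (Fin 3) L)) = 0)
    (mq : ∀ v : HeightOneSpectrum (𝓞 ↥(maximalRealSubfield L)), OrbitalMeasureFamily ((UnitaryGroup.cmDatum L 3 H₂).Local v))
    (hadm : ∀ v, (mq v).IsAdmissibleOn fun x : (UnitaryGroup.cmDatum L 3 H₂).Local v =>
      Corresponds (UnitaryGroup.conjLocal L (IsCMField.complexConj L) v) ((UnitaryGroup.adelicForm L 3 H₁).map (UnitaryGroup.adeleToLocal L v))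
        ((UnitaryGroup.adelicForm L 3 H₂).map (UnitaryGroup.adeleToLocal L v)) ((UnitaryGroup.cmDatum L 3 H₁).toLocal v ((UnitaryGroup.cmDatum L 3 H₁).toAdelic γ₀)) x)
    (hnormγ : ∃ S₀ : Finset (HeightOneSpectrum (𝓞 ↥(maximalRealSubfield L))), UnitaryGroup.IsNormalisedOff L 3 H₂ mq ((UnitaryGroup.cmDatum L 3 H₂).toAdelic γ) S₀) :
    ∀ p : MatchingAdeleG₂ L H₁ H₂ γ₀, ∃ S₀ : Finset (HeightOneSpectrum (𝓞 ↥(maximalRealSubfield L))), UnitaryGroup.IsNormalisedOff L 3 H₂ mq p.adele S₀ :=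
  MatchingAdeleG₂.forall_exists_isNormalisedOff_of_isSemisimpleElt hH₂ hdet hγ (isSemisimple_toLin'_of_mul_sub_eq_zero hab hγab) mq hadm hnormγ

/-- **`hnorm` from `hnormγ` on `U(H₂)` at a CENTRAL class `γ₀ = ζ • 1`** (§1 at `(a, b) := (ζ, ζ + 1)`). [cite: Rogawski1990, §4.3 p. 44] [cite: Kottwitz1986, Prop. 7.1] -/
theorem MatchingAdeleG₂.forall_exists_isNormalisedOff_of_eq_smul_one (hH₂ : (H₂.map (cmConjRingHom L))ᵀ = H₂) (hdet : H₂.det ≠ 0)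
    (hγ : Corresponds (cmConjRingHom L) H₁ H₂ γ₀ γ) {ζ : L}
    (hζ : ((((γ₀ : unitaryGroup (cmConjRingHom L) H₁).val : GL (Fin 3) L).val : Matrix (Fin 3) (Fin 3) L)) = ζ • (1 : Matrix (Fin 3) (Fin 3) L))
    (mq : ∀ v : HeightOneSpectrum (𝓞 ↥(maximalRealSubfield L)), OrbitalMeasureFamily ((UnitaryGroup.cmDatum L 3 H₂).Local v))
    (hadm : ∀ v, (mq v).IsAdmissibleOn fun x : (UnitaryGroup.cmDatum L 3 H₂).Local v =>
      Corresponds (UnitaryGroup.conjLocal L (IsCMField.complexConj L) v) ((UnitaryGroup.adelicForm L 3 H₁).map (UnitaryGroup.adeleToLocal L v))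
        ((UnitaryGroup.adelicForm L 3 H₂).map (UnitaryGroup.adeleToLocal L v)) ((UnitaryGroup.cmDatum L 3 H₁).toLocal v ((UnitaryGroup.cmDatum L 3 H₁).toAdelic γ₀)) x)
    (hnormγ : ∃ S₀ : Finset (HeightOneSpectrum (𝓞 ↥(maximalRealSubfield L))), UnitaryGroup.IsNormalisedOff L 3 H₂ mq ((UnitaryGroup.cmDatum L 3 H₂).toAdelic γ) S₀) :
    ∀ p : MatchingAdeleG₂ L H₁ H₂ γ₀, ∃ S₀ : Finset (HeightOneSpectrum (𝓞 ↥(maximalRealSubfield L))), UnitaryGroup.IsNormalisedOff L 3 H₂ mq p.adele S₀ :=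
  MatchingAdeleG₂.forall_exists_isNormalisedOff_of_mul_sub_eq_zero hH₂ hdet hγ (a := ζ) (b := ζ + 1) (by simp) (by rw [hζ, sub_self, zero_mul])
    mq hadm hnormγ

end G2

/-! ## §2 The side `U(Φ₃)` (abstract local families `mq`): `hnorm` from `hnormγ` at a semisimple base class -/

section G

variable {L : Type} [Field L] [NumberField L] [IsCMField L] {H : Matrix (Fin 3) (Fin 3) L}
  {γ₀ : (UnitaryGroup.cmDatum L 3 H).Rational}
  {γ : (UnitaryGroup.cmDatum L 3 (Matrix.of fun i j : Fin 3 => if i.val + j.val + 1 = 3 then (1 : L) else 0)).Rational}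
  [∀ (v : HeightOneSpectrum (𝓞 ↥(maximalRealSubfield L)))
    (x : (UnitaryGroup.cmDatum L 3 (Matrix.of fun i j : Fin 3 => if i.val + j.val + 1 = 3 then (1 : L) else 0)).Local v),
    MeasurableSpace ((UnitaryGroup.cmDatum L 3 (Matrix.of fun i j : Fin 3 => if i.val + j.val + 1 = 3 then (1 : L) else 0)).Local v ⧸
      Subgroup.centralizer ({x} : Set ((UnitaryGroup.cmDatum L 3 (Matrix.of fun i j : Fin 3 => if i.val + j.val + 1 = 3 then (1 : L) else 0)).Local v)))]
  [∀ (v : HeightOneSpectrum (𝓞 ↥(maximalRealSubfield L)))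
    (x : (UnitaryGroup.cmDatum L 3 (Matrix.of fun i j : Fin 3 => if i.val + j.val + 1 = 3 then (1 : L) else 0)).Local v),
    BorelSpace ((UnitaryGroup.cmDatum L 3 (Matrix.of fun i j : Fin 3 => if i.val + j.val + 1 = 3 then (1 : L) else 0)).Local v ⧸
      Subgroup.centralizer ({x} : Set ((UnitaryGroup.cmDatum L 3 (Matrix.of fun i j : Fin 3 => if i.val + j.val + 1 = 3 then (1 : L) else 0)).Local v)))]

/-- **`hnorm` FROM `hnormγ` ON THE QUASI-SPLIT `U(Φ₃)`, AT A SEMISIMPLE BASE CLASS** (abstract local families `mq v` on `U(Φ₃)(L⁺_v)`; the binders `hγ mq hadm hnormγ`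
of ★ `MatchingAdeleG.exists_forall_isEulerOnClasses_ofLocalAdelic_of_mul_sub_eq_zero` VERBATIM): `γ₀ ∈ U(H)(L⁺)` semisimple with rational correspondent
`γ ∈ U(Φ₃)(L⁺)`; `mq v` admissible on the classes corresponding to `(γ₀)_v`; `mq` normalised off a finite set at `toAdelic γ`.  THEN `mq` is normalised off a finite
set at every matching adèle `p ∈ 𝒪_st(γ₀ ∕ 𝐀) ⊂ U(Φ₃)(𝐀)` (★ K6-α `MatchingAdeleG.eventuallyKConj_of_isSemisimpleElt` read on matching adèles by ★
`MatchingAdeleG.eventually_forall_exists_conj_of_eventuallyKConj`; ★ `UnitaryGroup.exists_isNormalisedOff_of_eventually_exists_mem_conj`).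
[cite: Rogawski1990, §3.3 p. 21; §4.3 p. 44] [cite: Kottwitz1986, Prop. 7.1] -/
theorem MatchingAdeleG.forall_exists_isNormalisedOff_of_isSemisimpleElt
    (hγ : Corresponds (cmConjRingHom L) H (Matrix.of fun i j : Fin 3 => if i.val + j.val + 1 = 3 then (1 : L) else 0) γ₀ γ)
    (hss₀ : IsSemisimpleElt (cmConjRingHom L) H γ₀)
    (mq : ∀ v : HeightOneSpectrum (𝓞 ↥(maximalRealSubfield L)),
      OrbitalMeasureFamily ((UnitaryGroup.cmDatum L 3 (Matrix.of fun i j : Fin 3 => if i.val + j.val + 1 = 3 then (1 : L) else 0)).Local v))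
    (hadm : ∀ v, (mq v).IsAdmissibleOn fun x : (UnitaryGroup.cmDatum L 3 (Matrix.of fun i j : Fin 3 => if i.val + j.val + 1 = 3 then (1 : L) else 0)).Local v =>
      Corresponds (UnitaryGroup.conjLocal L (IsCMField.complexConj L) v)
        ((UnitaryGroup.adelicForm L 3 H).map (UnitaryGroup.adeleToLocal L v))
        ((UnitaryGroup.adelicForm L 3 (Matrix.of fun i j : Fin 3 => if i.val + j.val + 1 = 3 then (1 : L) else 0)).map (UnitaryGroup.adeleToLocal L v))
        ((UnitaryGroup.cmDatum L 3 H).toLocal v ((UnitaryGroup.cmDatum L 3 H).toAdelic γ₀)) x)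
    (hnormγ : ∃ S₀ : Finset (HeightOneSpectrum (𝓞 ↥(maximalRealSubfield L))),
      UnitaryGroup.IsNormalisedOff L 3 (Matrix.of fun i j : Fin 3 => if i.val + j.val + 1 = 3 then (1 : L) else 0) mq
        ((UnitaryGroup.cmDatum L 3 (Matrix.of fun i j : Fin 3 => if i.val + j.val + 1 = 3 then (1 : L) else 0)).toAdelic γ) S₀) :
    ∀ p : MatchingAdeleG L H γ₀, ∃ S₀ : Finset (HeightOneSpectrum (𝓞 ↥(maximalRealSubfield L))),
      UnitaryGroup.IsNormalisedOff L 3 (Matrix.of fun i j : Fin 3 => if i.val + j.val + 1 = 3 then (1 : L) else 0) mq p.adele S₀ := by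
  intro p
  refine UnitaryGroup.exists_isNormalisedOff_of_eventually_exists_mem_conj L 3 _ mq hnormγ ?_
    (Filter.Eventually.of_forall fun v =>
      (hadm v _ ((corresponds_toLocal_toAdelic hγ v).of_isStablyConj_right (isStablyConj_of_isConj (isConj_out_conjClasses_mk _)))).2.1)
  filter_upwards [MatchingAdeleG.eventually_forall_exists_conj_of_eventuallyKConj (MatchingAdeleG.eventuallyKConj_of_isSemisimpleElt hss₀ hγ),
    eventually_toLocal_mem_cmLocalIntegralLevel p.adele] with v hv hint
  exact hv p hint

/-- **`hnorm` from `hnormγ` on `U(Φ₃)` at a SPLIT SEMISIMPLE class `(γ₀ − a)(γ₀ − b) = 0`, `a ≠ b`** (binders of ★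
`MatchingAdeleG.exists_forall_isEulerOnClasses_ofLocalAdelic_of_mul_sub_eq_zero` VERBATIM). [cite: Rogawski1990, §3.3 p. 21; §4.3 p. 44] [cite: Kottwitz1986, Prop. 7.1] -/
theorem MatchingAdeleG.forall_exists_isNormalisedOff_of_mul_sub_eq_zero
    (hγ : Corresponds (cmConjRingHom L) H (Matrix.of fun i j : Fin 3 => if i.val + j.val + 1 = 3 then (1 : L) else 0) γ₀ γ)
    {a b : L} (hab : a ≠ b)
    (hγab : ((((γ₀ : unitaryGroup (cmConjRingHom L) H).val : GL (Fin 3) L).val : Matrix (Fin 3) (Fin 3) L) - a • (1 : Matrix (Fin 3) (Fin 3) L)) *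
      ((((γ₀ : unitaryGroup (cmConjRingHom L) H).val : GL (Fin 3) L).val : Matrix (Fin 3) (Fin 3) L) - b • (1 : Matrix (Fin 3) (Fin 3) L)) = 0)
    (mq : ∀ v : HeightOneSpectrum (𝓞 ↥(maximalRealSubfield L)),
      OrbitalMeasureFamily ((UnitaryGroup.cmDatum L 3 (Matrix.of fun i j : Fin 3 => if i.val + j.val + 1 = 3 then (1 : L) else 0)).Local v))
    (hadm : ∀ v, (mq v).IsAdmissibleOn fun x : (UnitaryGroup.cmDatum L 3 (Matrix.of fun i j : Fin 3 => if i.val + j.val + 1 = 3 then (1 : L) else 0)).Local v =>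
      Corresponds (UnitaryGroup.conjLocal L (IsCMField.complexConj L) v)
        ((UnitaryGroup.adelicForm L 3 H).map (UnitaryGroup.adeleToLocal L v))
        ((UnitaryGroup.adelicForm L 3 (Matrix.of fun i j : Fin 3 => if i.val + j.val + 1 = 3 then (1 : L) else 0)).map (UnitaryGroup.adeleToLocal L v))
        ((UnitaryGroup.cmDatum L 3 H).toLocal v ((UnitaryGroup.cmDatum L 3 H).toAdelic γ₀)) x)
    (hnormγ : ∃ S₀ : Finset (HeightOneSpectrum (𝓞 ↥(maximalRealSubfield L))),
      UnitaryGroup.IsNormalisedOff L 3 (Matrix.of fun i j : Fin 3 => if i.val + j.val + 1 = 3 then (1 : L) else 0) mq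
        ((UnitaryGroup.cmDatum L 3 (Matrix.of fun i j : Fin 3 => if i.val + j.val + 1 = 3 then (1 : L) else 0)).toAdelic γ) S₀) :
    ∀ p : MatchingAdeleG L H γ₀, ∃ S₀ : Finset (HeightOneSpectrum (𝓞 ↥(maximalRealSubfield L))),
      UnitaryGroup.IsNormalisedOff L 3 (Matrix.of fun i j : Fin 3 => if i.val + j.val + 1 = 3 then (1 : L) else 0) mq p.adele S₀ :=
  MatchingAdeleG.forall_exists_isNormalisedOff_of_isSemisimpleElt hγ (isSemisimple_toLin'_of_mul_sub_eq_zero hab hγab) mq hadm hnormγ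

/-- **`hnorm` from `hnormγ` on `U(Φ₃)` at a CENTRAL class `γ₀ = ζ • 1`** (§2 at `(a, b) := (ζ, ζ + 1)`; binders of ★
`MatchingAdeleG.exists_forall_isEulerOnClasses_ofLocalAdelic_of_eq_smul_one` VERBATIM). [cite: Rogawski1990, §4.3 p. 44] [cite: Kottwitz1986, Prop. 7.1] -/
theorem MatchingAdeleG.forall_exists_isNormalisedOff_of_eq_smul_one
    (hγ : Corresponds (cmConjRingHom L) H (Matrix.of fun i j : Fin 3 => if i.val + j.val + 1 = 3 then (1 : L) else 0) γ₀ γ)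
    {ζ : L} (hζ : ((((γ₀ : unitaryGroup (cmConjRingHom L) H).val : GL (Fin 3) L).val : Matrix (Fin 3) (Fin 3) L)) = ζ • (1 : Matrix (Fin 3) (Fin 3) L))
    (mq : ∀ v : HeightOneSpectrum (𝓞 ↥(maximalRealSubfield L)),
      OrbitalMeasureFamily ((UnitaryGroup.cmDatum L 3 (Matrix.of fun i j : Fin 3 => if i.val + j.val + 1 = 3 then (1 : L) else 0)).Local v))
    (hadm : ∀ v, (mq v).IsAdmissibleOn fun x : (UnitaryGroup.cmDatum L 3 (Matrix.of fun i j : Fin 3 => if i.val + j.val + 1 = 3 then (1 : L) else 0)).Local v =>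
      Corresponds (UnitaryGroup.conjLocal L (IsCMField.complexConj L) v)
        ((UnitaryGroup.adelicForm L 3 H).map (UnitaryGroup.adeleToLocal L v))
        ((UnitaryGroup.adelicForm L 3 (Matrix.of fun i j : Fin 3 => if i.val + j.val + 1 = 3 then (1 : L) else 0)).map (UnitaryGroup.adeleToLocal L v))
        ((UnitaryGroup.cmDatum L 3 H).toLocal v ((UnitaryGroup.cmDatum L 3 H).toAdelic γ₀)) x)
    (hnormγ : ∃ S₀ : Finset (HeightOneSpectrum (𝓞 ↥(maximalRealSubfield L))),
      UnitaryGroup.IsNormalisedOff L 3 (Matrix.of fun i j : Fin 3 => if i.val + j.val + 1 = 3 then (1 : L) else 0) mq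
        ((UnitaryGroup.cmDatum L 3 (Matrix.of fun i j : Fin 3 => if i.val + j.val + 1 = 3 then (1 : L) else 0)).toAdelic γ) S₀) :
    ∀ p : MatchingAdeleG L H γ₀, ∃ S₀ : Finset (HeightOneSpectrum (𝓞 ↥(maximalRealSubfield L))),
      UnitaryGroup.IsNormalisedOff L 3 (Matrix.of fun i j : Fin 3 => if i.val + j.val + 1 = 3 then (1 : L) else 0) mq p.adele S₀ :=
  MatchingAdeleG.forall_exists_isNormalisedOff_of_mul_sub_eq_zero hγ (a := ζ) (b := ζ + 1) (by simp) (by rw [hζ, sub_self, zero_mul]) mq hadm hnormγ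

end G

/-! ## §3 The kit's transported family `mq v := (ψ_v)_* mG v`: `hnormγ` AND `hnorm` from the PIN at the base class `γ₀` of the inner form -/

section Transport

variable (L : Type) [Field L] [NumberField L] [IsCMField L] (H : Matrix (Fin 3) (Fin 3) L)
  [∀ (v : HeightOneSpectrum (𝓞 ↥(maximalRealSubfield L))) (x : (UnitaryGroup.cmDatum L 3 H).Local v),
    MeasurableSpace ((UnitaryGroup.cmDatum L 3 H).Local v ⧸ Subgroup.centralizer ({x} : Set ((UnitaryGroup.cmDatum L 3 H).Local v)))]
  [∀ (v : HeightOneSpectrum (𝓞 ↥(maximalRealSubfield L))) (x : (UnitaryGroup.cmDatum L 3 H).Local v),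
    BorelSpace ((UnitaryGroup.cmDatum L 3 H).Local v ⧸ Subgroup.centralizer ({x} : Set ((UnitaryGroup.cmDatum L 3 H).Local v)))]
  [∀ (v : HeightOneSpectrum (𝓞 ↥(maximalRealSubfield L)))
    (x : (UnitaryGroup.cmDatum L 3 (Matrix.of fun i j : Fin 3 => if i.val + j.val + 1 = 3 then (1 : L) else 0)).Local v),
    MeasurableSpace ((UnitaryGroup.cmDatum L 3 (Matrix.of fun i j : Fin 3 => if i.val + j.val + 1 = 3 then (1 : L) else 0)).Local v ⧸
      Subgroup.centralizer ({x} : Set ((UnitaryGroup.cmDatum L 3 (Matrix.of fun i j : Fin 3 => if i.val + j.val + 1 = 3 then (1 : L) else 0)).Local v)))]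
  [∀ (v : HeightOneSpectrum (𝓞 ↥(maximalRealSubfield L)))
    (x : (UnitaryGroup.cmDatum L 3 (Matrix.of fun i j : Fin 3 => if i.val + j.val + 1 = 3 then (1 : L) else 0)).Local v),
    BorelSpace ((UnitaryGroup.cmDatum L 3 (Matrix.of fun i j : Fin 3 => if i.val + j.val + 1 = 3 then (1 : L) else 0)).Local v ⧸
      Subgroup.centralizer ({x} : Set ((UnitaryGroup.cmDatum L 3 (Matrix.of fun i j : Fin 3 => if i.val + j.val + 1 = 3 then (1 : L) else 0)).Local v)))]
  -- the local congruences `ψ_v : U(H)(L⁺_v) ≃ₜ* U(Φ₃)(L⁺_v)`, class-preserving backwards, level matching off `S₀` (★ `OrbitalMeasureFamilyTransport` §3 letters)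
  (ψ : ∀ v : HeightOneSpectrum (𝓞 ↥(maximalRealSubfield L)), (UnitaryGroup.cmDatum L 3 H).Local v ≃ₜ*
    (UnitaryGroup.cmDatum L 3 (Matrix.of fun i j : Fin 3 => if i.val + j.val + 1 = 3 then (1 : L) else 0)).Local v)
  (hcorr' : ∀ v (x : (UnitaryGroup.cmDatum L 3 (Matrix.of fun i j : Fin 3 => if i.val + j.val + 1 = 3 then (1 : L) else 0)).Local v),
    Corresponds (UnitaryGroup.conjLocal L (IsCMField.complexConj L) v) ((UnitaryGroup.adelicForm L 3 H).map (UnitaryGroup.adeleToLocal L v))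
      ((UnitaryGroup.adelicForm L 3 (Matrix.of fun i j : Fin 3 => if i.val + j.val + 1 = 3 then (1 : L) else 0)).map (UnitaryGroup.adeleToLocal L v))
      ((ψ v).symm x) x)
  (S₀ : Finset (HeightOneSpectrum (𝓞 ↥(maximalRealSubfield L))))
  (hψK : ∀ v, v ∉ S₀ → ∀ g, ψ v g ∈ UnitaryGroup.cmLocalIntegralLevel L 3 (Matrix.of fun i j : Fin 3 => if i.val + j.val + 1 = 3 then (1 : L) else 0) v ↔
    g ∈ UnitaryGroup.cmLocalIntegralLevel L 3 H v)
  {mG : ∀ v : HeightOneSpectrum (𝓞 ↥(maximalRealSubfield L)), OrbitalMeasureFamily ((UnitaryGroup.cmDatum L 3 H).Local v)}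

include hcorr' hψK

set_option maxHeartbeats 400000 in
/-- **The transported family is normalised off a finite set at EVERY adelic point of `U(Φ₃)` corresponding to `γ₀` place by place — FROM THE PIN AT `γ₀`.**
`H` hermitian with `det H ≠ 0`; `γ₀ ∈ U(H)(L⁺)` SEMISIMPLE; `mG v` admissible on the classes stably conjugate to `(γ₀)_v` (`hadm`) and normalised off a finite set at
`toAdelic γ₀` (`hpin` — SPEC-O7 (ix-s) at the rational class); `ψ_v`, `hcorr'`, level matching off `S₀` as in ★ `OrbitalMeasureFamilyTransport` §3.  THEN for every
adelic `x ∈ U(Φ₃)(𝐀)` with `(γ₀)_v ↔ x_v` at every finite `v`: `∃ S, IsNormalisedOff L 3 Φ₃ (v ↦ (ψ_v)_* mG v) x S`.  Road: off the level-matching set the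
`π U(Φ₃)(𝒪_v)`-mass of `(ψ_v)_* mG v` at `x_v` is the `π U(H)(𝒪_v)`-mass of `mG v` at `y_v := ψ_v⁻¹ x_v` (★ `transport_atPoint_image_cmLocalIntegralLevel`); `y_v ∼_st (γ₀)_v`
(`hcorr'`), `y_v ∈ U(H)(𝒪_v)` a.e., so `y_v = k (γ₀)_v k⁻¹`, `k ∈ U(H)(𝒪_v)`, a.e. (★ K6-α `eventually_forall_integralConj_cmDatum_of_isSemisimpleElt`); and the
mass at `k (γ₀)_v k⁻¹` is the mass at `(γ₀)_v` (★ `OrbitalMeasureFamily.atPoint_conj_apply_image_mk_of_mem`, invariance from `hadm`) `= 1` (`hpin`).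
[cite: Rogawski1990, §3.3 p. 21; §4.3 p. 44; §14.2 p. 232] [cite: Kottwitz1986, Prop. 7.1; §7.3] -/
theorem exists_isNormalisedOff_transport_of_forall_corresponds (hH : (H.map (cmConjRingHom L))ᵀ = H) (hHd : H.det ≠ 0)
    {γ₀ : (UnitaryGroup.cmDatum L 3 H).Rational} (hss₀ : IsSemisimpleElt (cmConjRingHom L) H γ₀)
    (hadm : ∀ v, (mG v).IsAdmissibleOn fun y : (UnitaryGroup.cmDatum L 3 H).Local v =>
      Corresponds (UnitaryGroup.conjLocal L (IsCMField.complexConj L) v) ((UnitaryGroup.adelicForm L 3 H).map (UnitaryGroup.adeleToLocal L v))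
        ((UnitaryGroup.adelicForm L 3 H).map (UnitaryGroup.adeleToLocal L v)) ((UnitaryGroup.cmDatum L 3 H).toLocal v ((UnitaryGroup.cmDatum L 3 H).toAdelic γ₀)) y)
    (hpin : ∃ S₁ : Finset (HeightOneSpectrum (𝓞 ↥(maximalRealSubfield L))), UnitaryGroup.IsNormalisedOff L 3 H mG ((UnitaryGroup.cmDatum L 3 H).toAdelic γ₀) S₁)
    (x : (UnitaryGroup.cmDatum L 3 (Matrix.of fun i j : Fin 3 => if i.val + j.val + 1 = 3 then (1 : L) else 0)).Adelic)
    (hx : ∀ v, Corresponds (UnitaryGroup.conjLocal L (IsCMField.complexConj L) v) ((UnitaryGroup.adelicForm L 3 H).map (UnitaryGroup.adeleToLocal L v))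
      ((UnitaryGroup.adelicForm L 3 (Matrix.of fun i j : Fin 3 => if i.val + j.val + 1 = 3 then (1 : L) else 0)).map (UnitaryGroup.adeleToLocal L v))
      ((UnitaryGroup.cmDatum L 3 H).toLocal v ((UnitaryGroup.cmDatum L 3 H).toAdelic γ₀))
      ((UnitaryGroup.cmDatum L 3 (Matrix.of fun i j : Fin 3 => if i.val + j.val + 1 = 3 then (1 : L) else 0)).toLocal v x)) :
    ∃ S : Finset (HeightOneSpectrum (𝓞 ↥(maximalRealSubfield L))),
      UnitaryGroup.IsNormalisedOff L 3 (Matrix.of fun i j : Fin 3 => if i.val + j.val + 1 = 3 then (1 : L) else 0)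
        (fun v => (mG v).transport (ψ v).toMulEquiv (ψ v).continuous (ψ v).symm.continuous) x S := by
  classical
  obtain ⟨S₁, hS₁⟩ := hpin
  -- `y_v := ψ_v⁻¹ x_v` is stably conjugate to `(γ₀)_v` at every `v`
  have hst : ∀ v, IsStablyConj (UnitaryGroup.conjLocal L (IsCMField.complexConj L) v) ((UnitaryGroup.adelicForm L 3 H).map (UnitaryGroup.adeleToLocal L v))
      ((UnitaryGroup.cmDatum L 3 H).toLocal v ((UnitaryGroup.cmDatum L 3 H).toAdelic γ₀))
      ((ψ v).symm ((UnitaryGroup.cmDatum L 3 (Matrix.of fun i j : Fin 3 => if i.val + j.val + 1 = 3 then (1 : L) else 0)).toLocal v x)) :=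
    fun v => (hx v).isStablyConj_left (hcorr' v _)
  -- a.e. `v`: `y_v ∈ U(H)(𝒪_v)` is `U(H)(𝒪_v)`-conjugate to `(γ₀)_v`
  have hconj : ∀ᶠ v in cofinite, v ∉ S₀ → ∃ k ∈ UnitaryGroup.cmLocalIntegralLevel L 3 H v,
      k * (UnitaryGroup.cmDatum L 3 H).toLocal v ((UnitaryGroup.cmDatum L 3 H).toAdelic γ₀) * k⁻¹ =
        (ψ v).symm ((UnitaryGroup.cmDatum L 3 (Matrix.of fun i j : Fin 3 => if i.val + j.val + 1 = 3 then (1 : L) else 0)).toLocal v x) := by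
    filter_upwards [eventually_forall_integralConj_cmDatum_of_isSemisimpleElt L H hH hHd γ₀ hss₀, eventually_toLocal_mem_cmLocalIntegralLevel x]
      with v hv hxint hvS₀
    refine hv _ ?_ (IsConj.symm (hst v))
    have h := (hψK v hvS₀ ((ψ v).symm ((UnitaryGroup.cmDatum L 3 (Matrix.of fun i j : Fin 3 => if i.val + j.val + 1 = 3 then (1 : L) else 0)).toLocal v x))).1
    rw [ContinuousMulEquiv.apply_symm_apply] at h
    exact h hxint
  rw [Filter.eventually_cofinite] at hconj
  refine ⟨S₀ ∪ S₁ ∪ hconj.toFinset, fun v hv => ?_⟩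
  simp only [Finset.mem_union, not_or] at hv
  have hk : v ∉ S₀ → ∃ k ∈ UnitaryGroup.cmLocalIntegralLevel L 3 H v,
      k * (UnitaryGroup.cmDatum L 3 H).toLocal v ((UnitaryGroup.cmDatum L 3 H).toAdelic γ₀) * k⁻¹ =
        (ψ v).symm ((UnitaryGroup.cmDatum L 3 (Matrix.of fun i j : Fin 3 => if i.val + j.val + 1 = 3 then (1 : L) else 0)).toLocal v x) := by
    by_contra h
    exact hv.2 (hconj.mem_toFinset.2 h)
  obtain ⟨k, hkK, hky⟩ := hk hv.1.1
  -- off the level-matching set: the `π U(Φ₃)(𝒪_v)`-mass of `(ψ_v)_* mG v` at `x_v` is the `π U(H)(𝒪_v)`-mass of `mG v` at `y_v` (invariance of `mG v ⟦y_v⟧` from `hadm`)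
  haveI : SMulInvariantMeasure ((UnitaryGroup.cmDatum L 3 H).Local v)
      ((UnitaryGroup.cmDatum L 3 H).Local v ⧸ Subgroup.centralizer
        ({(Quotient.out (ConjClasses.mk ((ψ v).symm ((UnitaryGroup.cmDatum L 3 (Matrix.of fun i j : Fin 3 => if i.val + j.val + 1 = 3 then (1 : L) else 0)).toLocal v x))) :
          (UnitaryGroup.cmDatum L 3 H).Local v)} : Set ((UnitaryGroup.cmDatum L 3 H).Local v)))
      ((mG v) (ConjClasses.mk ((ψ v).symm ((UnitaryGroup.cmDatum L 3 (Matrix.of fun i j : Fin 3 => if i.val + j.val + 1 = 3 then (1 : L) else 0)).toLocal v x)))) :=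
    (hadm v _ ((hst v).trans (isStablyConj_of_isConj (isConj_out_conjClasses_mk _)))).2.1
  dsimp only
  rw [transport_atPoint_image_cmLocalIntegralLevel L H ψ mG v (hψK v hv.1.1)]
  -- `y_v = k (γ₀)_v k⁻¹`: the mass at `(γ₀)_v` (invariance of `mG v ⟦(γ₀)_v⟧`), `= 1` by the pin
  haveI := (hadm v _ ((IsStablyConj.refl _).trans (isStablyConj_of_isConj (isConj_out_conjClasses_mk
    ((UnitaryGroup.cmDatum L 3 H).toLocal v ((UnitaryGroup.cmDatum L 3 H).toAdelic γ₀)))))).2.1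
  rw [← hky, (mG v).atPoint_conj_apply_image_mk_of_mem _ (UnitaryGroup.cmLocalIntegralLevel L 3 H v) hkK]
  exact hS₁ v hv.1.2

/-- **`hnormγ` FOR THE TRANSPORTED FAMILY, FROM THE PIN AT `γ₀`**: at the rational correspondent `γ ∈ U(Φ₃)(L⁺)` of a semisimple `γ₀ ∈ U(H)(L⁺)`,
`∃ S, IsNormalisedOff L 3 Φ₃ (v ↦ (ψ_v)_* mG v) (toAdelic γ) S` (the previous theorem at `x := toAdelic γ`, ★ `corresponds_toLocal_toAdelic`) — the binder `hnormγ` of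
★ `MatchingAdeleG.exists_forall_isEulerOnClasses_ofLocalAdelic_of_mul_sub_eq_zero` for `mq := transport`, the singular twin of ★
`UnitaryGroup.exists_isNormalisedOff_transport_toAdelic` (canonicity replaced by the pin + admissibility). [cite: Rogawski1990, §4.3 p. 44; §14.2 p. 232] [cite: Kottwitz1986, Prop. 7.1] -/
theorem exists_isNormalisedOff_transport_toAdelic_of_isSemisimpleElt (hH : (H.map (cmConjRingHom L))ᵀ = H) (hHd : H.det ≠ 0)
    {γ₀ : (UnitaryGroup.cmDatum L 3 H).Rational} (hss₀ : IsSemisimpleElt (cmConjRingHom L) H γ₀)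
    {γ : (UnitaryGroup.cmDatum L 3 (Matrix.of fun i j : Fin 3 => if i.val + j.val + 1 = 3 then (1 : L) else 0)).Rational}
    (hγ : Corresponds (cmConjRingHom L) H (Matrix.of fun i j : Fin 3 => if i.val + j.val + 1 = 3 then (1 : L) else 0) γ₀ γ)
    (hadm : ∀ v, (mG v).IsAdmissibleOn fun y : (UnitaryGroup.cmDatum L 3 H).Local v =>
      Corresponds (UnitaryGroup.conjLocal L (IsCMField.complexConj L) v) ((UnitaryGroup.adelicForm L 3 H).map (UnitaryGroup.adeleToLocal L v))
        ((UnitaryGroup.adelicForm L 3 H).map (UnitaryGroup.adeleToLocal L v)) ((UnitaryGroup.cmDatum L 3 H).toLocal v ((UnitaryGroup.cmDatum L 3 H).toAdelic γ₀)) y)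
    (hpin : ∃ S₁ : Finset (HeightOneSpectrum (𝓞 ↥(maximalRealSubfield L))), UnitaryGroup.IsNormalisedOff L 3 H mG ((UnitaryGroup.cmDatum L 3 H).toAdelic γ₀) S₁) :
    ∃ S : Finset (HeightOneSpectrum (𝓞 ↥(maximalRealSubfield L))),
      UnitaryGroup.IsNormalisedOff L 3 (Matrix.of fun i j : Fin 3 => if i.val + j.val + 1 = 3 then (1 : L) else 0)
        (fun v => (mG v).transport (ψ v).toMulEquiv (ψ v).continuous (ψ v).symm.continuous)
        ((UnitaryGroup.cmDatum L 3 (Matrix.of fun i j : Fin 3 => if i.val + j.val + 1 = 3 then (1 : L) else 0)).toAdelic γ) S :=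
  exists_isNormalisedOff_transport_of_forall_corresponds L H ψ hcorr' S₀ hψK hH hHd hss₀ hadm hpin _ (corresponds_toLocal_toAdelic hγ)

/-- **`hnorm` FOR THE TRANSPORTED FAMILY, FROM THE PIN AT `γ₀`**: at every matching adèle `p ∈ 𝒪_st(γ₀ ∕ 𝐀) ⊂ U(Φ₃)(𝐀)` over a semisimple `γ₀ ∈ U(H)(L⁺)`,
`∃ S, IsNormalisedOff L 3 Φ₃ (v ↦ (ψ_v)_* mG v) p.adele S` (§3 at `x := p.adele`, ★ `MatchingAdeleG.corresponds_toLocal`) — the binder `hnorm` for `mq := transport`, the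
singular twin of ★ `UnitaryGroup.forall_exists_isNormalisedOff_transport_matchingAdeleG`. [cite: Rogawski1990, §3.3 p. 21; §4.3 p. 44; §14.2 p. 232] [cite: Kottwitz1986, Prop. 7.1] -/
theorem forall_exists_isNormalisedOff_transport_matchingAdeleG_of_isSemisimpleElt (hH : (H.map (cmConjRingHom L))ᵀ = H) (hHd : H.det ≠ 0)
    {γ₀ : (UnitaryGroup.cmDatum L 3 H).Rational} (hss₀ : IsSemisimpleElt (cmConjRingHom L) H γ₀)
    (hadm : ∀ v, (mG v).IsAdmissibleOn fun y : (UnitaryGroup.cmDatum L 3 H).Local v =>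
      Corresponds (UnitaryGroup.conjLocal L (IsCMField.complexConj L) v) ((UnitaryGroup.adelicForm L 3 H).map (UnitaryGroup.adeleToLocal L v))
        ((UnitaryGroup.adelicForm L 3 H).map (UnitaryGroup.adeleToLocal L v)) ((UnitaryGroup.cmDatum L 3 H).toLocal v ((UnitaryGroup.cmDatum L 3 H).toAdelic γ₀)) y)
    (hpin : ∃ S₁ : Finset (HeightOneSpectrum (𝓞 ↥(maximalRealSubfield L))), UnitaryGroup.IsNormalisedOff L 3 H mG ((UnitaryGroup.cmDatum L 3 H).toAdelic γ₀) S₁) :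
    ∀ p : MatchingAdeleG L H γ₀, ∃ S : Finset (HeightOneSpectrum (𝓞 ↥(maximalRealSubfield L))),
      UnitaryGroup.IsNormalisedOff L 3 (Matrix.of fun i j : Fin 3 => if i.val + j.val + 1 = 3 then (1 : L) else 0)
        (fun v => (mG v).transport (ψ v).toMulEquiv (ψ v).continuous (ψ v).symm.continuous) p.adele S :=
  fun p => exists_isNormalisedOff_transport_of_forall_corresponds L H ψ hcorr' S₀ hψK hH hHd hss₀ hadm hpin _ p.corresponds_toLocal

end Transport

end Literature.NumberTheory.Rogawski1990

end
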